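import Mathlib
import Literature.MathematicalPhysics.QuantumLattice.HubbardWave0RepulsiveProofs

/-!
# Sketch — spin-Reynolds SOUNDNESS for every arity from the Casimir alone
  («spin-free-checker», card rev 5 on stmt-Ventures-22024 `LowerEdge_ge_m83o100`; bears on
  stmt-Ventures-21721 `LowerEdge_ge_m4o5`; hub-lb-sym-idea-4 g3, team lb-sym, 2026-08-28)

WHAT IS PROVED HERE (≈ 400 lines, 33 theorems, 0 sorries; axioms propext / Classical.choice /
Quot.sound).  It REPLACES the per-arity table proofs of rev 4 as the soundness basis of the
SU(2) quotient (checker lever (d)).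
§1 Ring level.  For `E F H` with `[H,E] = 2E`, `[H,F] = -2F`, `[E,F] = H` put
  `C := 2(EF + FE) + H²` (four times the Casimir).  Then `C E = E C`, `C F = F C`
  (`casimir4_comm_E`, `casimir4_comm_F`; each uses two of the three relations).
§2 Module level.  For EVERY endomorphism `Q` commuting with `E`, `F` and EVERY vector `x`
  (no weight hypothesis on `x`; only `[E,F] = H` is used):
    `x - (1 - Q C) x = E (Q (2Fx + F(Hx))) + F (Q (2Ex - E(Hx)))`          (`sub_apply_eq`)
  — explicit Ward preimages — so `x - (1 - Q C) x ∈ range E ⊔ range F` (`sub_apply_mem`).  Every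
  polynomial in `C` commutes with `E, F` (`aeval_casimir4_comm`, via the centralizer subalgebra),
  hence for EVERY polynomial `p` with `p(0) = 1`:
    `x - p(C) x ∈ range E ⊔ range F`                                         (`sub_aeval_apply_mem`),
  in particular for the product projectors `∏_j (1 - a_j C)` (`sub_aevalProd_apply_mem`).  With
  `a_j = 1/(4j(j+1))`, `j = 1..k`, that operator is the projection onto the invariants of any
  finite-dimensional `𝔰𝔩₂`-module with spins `≤ k` along the other isotypic components (eigenvalue
  of `C` on spin `j` is `4j(j+1)`) — i.e. the spin-Reynolds map `R_k` which the rev-4 tables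
  tabulate on arity-`k` window monomials (`2k` doublet indices ⇒ spins `≤ k`).
§2b Transport.  If `ev : V → M` intertwines formal `E_f, F_f, H_f` with `E, F, H` (three identities —
  or TWO, with `H_f := [E_f, F_f]`, `comp_comm_of_comp_eq`; NO relation among the formal maps is
  needed) then `ev ∘ p(C_f) = p(C) ∘ ev` and
  `ev v - ev (p(C_f) v) ∈ range E ⊔ range F`                    (`transport_sub_aeval_mem`).
§3 Window level.  `E = ad S⁺`, `F = ad S⁻`, `H = ad (2S^z)` on `Op Λ = Matrix (Finset (Orb Λ)) _ ℂ`,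
  relations from the tree's `LiebTwo.isSu2Triple_spin` (`ad_rel_EF/HE/HF`).  For EVERY window
  operator `X` — any arity, any site-coincidence pattern, S^z-neutral or not — and every `p`,
  `p(0) = 1`:  `X - p(C_ad) X ∈ wardSpan Λ := range (ad S⁺) ⊔ range (ad S⁻)`
  (`window_sub_aeval_mem`, `window_sub_reynoldsPoly_mem`; explicit preimages `window_sub_apply_eq`);
  the checker's own FORMAL word module plugs in through `window_transport_sub_aeval_mem` /
  `window_transport_sub_aeval_mem₂` (two intertwining identities for its formal `[S⁺,·]`, `[S⁻,·]` on
  words — each one Leibniz induction (`ad_mul`) + the letter table of the rev-2 sketch; in `symreplay`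
  terms: `polyOp (comm spinPlusPoly v) = [S⁺, polyOp v]`, available from `stub_nfFaithful` + `dict_spinPlus`);
  and every Ward-null functional agrees on `X` and `p(C_ad) X` (`wardNull_apply_aeval_eq`) — the
  replay checker's final step, all arities at once.

CHECKER RECIPE (rev 5).  (i) per arity `k`, compute `R_k := p_k(C_f)` ONCE as an exact rational
`4^k × 4^k` matrix on formal dressings (block-diagonal by S^z-weight; `k = 5`: 1024², `k = 6`: 4096²)
— or keep the closed-form pairing tables as a cache and CHECK them against `p_k(C_f)` by one exact
matrix comparison per arity; (ii) soundness in Lean = this file + the two intertwining identities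
for the checker's `wordOp`/`polyOp` (one Leibniz induction each, generic in `k`); no complete-reducibility, no
uniqueness, no per-arity or per-site-pattern Lean proof.

WHY IT MATTERS (22024 checker lane, lever (d) ÷7.03 pair classes at E₁, crit-1 V56).  Rev 4 proved
rows `k ≤ 4` by 17 generated files (≈ 2.6 MB) and left row `k = 5` (charged `mm.c1` blocks: 71 064
of 2.48e8 pairs at E₁) and every higher arity OPEN in Lean; they are now covered.  `Op`, `ad`,
`wardSpan` are the same terms as in `SketchSpinFreeChecker_symidea4.lean` (definitionally).
HONEST FRAMING: operator identities only — a COST lever for the checker; nothing here bounds an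
energy; no summit statement and no crux is proved by this file.
-/

namespace Summit.Ventures.CertifiedManyBodySolver.Cruxes.LowerEdge_ge_m83o100.SpinReynoldsCasimir

/-! ## 1. Ring level: the Casimir of an `𝔰𝔩₂`-triple is central -/
section RingLevel

variable {A : Type*} [Ring A]

/-- Four times the Casimir: `C = 2(EF + FE) + H²` (no `½` needed). -/
def casimir4 (E F H : A) : A := 2 * (E * F + F * E) + H * H

theorem casimir4_swap (E F H : A) : casimir4 F E (-H) = casimir4 E F H := by
  simp only [casimir4, neg_mul_neg, add_comm (F * E)]

/-- `C E = E C`; uses only `[H,E] = 2E` and `[E,F] = H`. -/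
theorem casimir4_comm_E (E F H : A) (he : H * E - E * H = 2 * E) (ef : E * F - F * E = H) :
    casimir4 E F H * E = E * casimir4 E F H := by
  have h3 : H * E = E * H + 2 * E := by rw [← he]; abel
  have ef' : E * F = F * E + H := by rw [← ef]; abel
  have h1 : E * E * F = F * E * E + H * E + E * H := by
    calc E * E * F = E * (E * F) := by rw [mul_assoc]
      _ = E * (F * E + H) := by rw [ef']
      _ = (E * F) * E + E * H := by noncomm_ring
      _ = (F * E + H) * E + E * H := by rw [ef']
      _ = F * E * E + H * E + E * H := by noncomm_ring
  have h2 : H * H * E = E * H * H + 4 * (E * H) + 4 * E := by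
    calc H * H * E = H * (H * E) := by rw [mul_assoc]
      _ = H * (E * H + 2 * E) := by rw [h3]
      _ = (H * E) * H + 2 * (H * E) := by noncomm_ring
      _ = (E * H + 2 * E) * H + 2 * (E * H + 2 * E) := by rw [h3]
      _ = E * H * H + 4 * (E * H) + 4 * E := by noncomm_ring
  calc casimir4 E F H * E = 2 * (E * F * E) + 2 * (F * E * E) + H * H * E := by
        unfold casimir4; noncomm_ring
    _ = 2 * (E * F * E) + 2 * (F * E * E) + (E * H * H + 4 * (E * H) + 4 * E) := by rw [h2]
    _ = 2 * (E * F * E) + 2 * (F * E * E + H * E + E * H) - 2 * (H * E) - 2 * (E * H)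
          + (E * H * H + 4 * (E * H) + 4 * E) := by noncomm_ring
    _ = 2 * (E * F * E) + 2 * (E * E * F) - 2 * (E * H + 2 * E) - 2 * (E * H)
          + (E * H * H + 4 * (E * H) + 4 * E) := by rw [← h1, h3]
    _ = E * casimir4 E F H := by unfold casimir4; noncomm_ring

/-- `C F = F C`; uses only `[H,F] = -2F` and `[E,F] = H` (the mirror `(F, E, -H)` of the above). -/
theorem casimir4_comm_F (E F H : A) (hf : H * F - F * H = -(2 * F)) (ef : E * F - F * E = H) :
    casimir4 E F H * F = F * casimir4 E F H := by
  have he' : (-H) * F - F * (-H) = 2 * F := by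
    have h := congrArg Neg.neg hf
    rw [neg_neg] at h
    rw [← h]; noncomm_ring
  have ef' : F * E - E * F = -H := by rw [← ef]; abel
  have h := casimir4_comm_E F E (-H) he' ef'
  rwa [casimir4_swap] at h

end RingLevel

/-! ## 2. Module level: `1 - Q·C` differs from `1` by explicit elements of `range E ⊔ range F` -/
section ModuleLevel

variable {R : Type*} [CommRing R] {M : Type*} [AddCommGroup M] [Module R M]

/-- The WARD SUBMODULE `range E ⊔ range F`. -/
def wardSub (E F : Module.End R M) : Submodule R M := LinearMap.range E ⊔ LinearMap.range F

theorem apply_add_apply_mem_wardSub (E F : Module.End R M) (y z : M) : E y + F z ∈ wardSub E F :=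
  Submodule.add_mem _ (Submodule.mem_sup_left (LinearMap.mem_range_self E y))
    (Submodule.mem_sup_right (LinearMap.mem_range_self F z))

/-- `C x = E (2Fx + F(Hx)) + F (2Ex - E(Hx))`; uses only `[E,F] = H`. -/
theorem casimir4_apply (E F H : Module.End R M) (ef : E * F - F * E = H) (x : M) :
    casimir4 E F H x = E ((2 : R) • F x + F (H x)) + F ((2 : R) • E x - E (H x)) := by
  have hH : H (H x) = E (F (H x)) - F (E (H x)) := by
    have h := LinearMap.congr_fun ef (H x)
    simpa only [LinearMap.sub_apply, Module.End.mul_apply] using h.symm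
  simp only [casimir4, LinearMap.add_apply, Module.End.mul_apply, Module.End.ofNat_apply, map_add,
    map_sub, map_smul, hH]
  module

/-- CORE IDENTITY (explicit Ward preimages).  If `Q` commutes with `E` and `F` then for every `x`:
`x - (1 - Q C) x = E (Q (2Fx + F(Hx))) + F (Q (2Ex - E(Hx)))`. -/
theorem sub_apply_eq (E F H Q : Module.End R M) (ef : E * F - F * E = H)
    (hQE : E * Q = Q * E) (hQF : F * Q = Q * F) (x : M) :
    x - (1 - Q * casimir4 E F H) x =
      E (Q ((2 : R) • F x + F (H x))) + F (Q ((2 : R) • E x - E (H x))) := by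
  have hQE' : ∀ y, Q (E y) = E (Q y) := fun y => by
    simpa only [Module.End.mul_apply] using (LinearMap.congr_fun hQE y).symm
  have hQF' : ∀ y, Q (F y) = F (Q y) := fun y => by
    simpa only [Module.End.mul_apply] using (LinearMap.congr_fun hQF y).symm
  rw [LinearMap.sub_apply, Module.End.one_apply, Module.End.mul_apply, sub_sub_cancel,
    casimir4_apply E F H ef, map_add, hQE', hQF']

/-- … hence `x - (1 - Q C) x ∈ range E ⊔ range F` for every `x` (no weight hypothesis on `x`). -/
theorem sub_apply_mem (E F H Q : Module.End R M) (ef : E * F - F * E = H)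
    (hQE : E * Q = Q * E) (hQF : F * Q = Q * F) (x : M) :
    x - (1 - Q * casimir4 E F H) x ∈ wardSub E F := by
  rw [sub_apply_eq E F H Q ef hQE hQF x]
  exact apply_add_apply_mem_wardSub E F _ _

/-- `C` lies in the commutant of `{E, F}` … -/
theorem casimir4_mem_centralizer (E F H : Module.End R M) (he : H * E - E * H = 2 * E)
    (hf : H * F - F * H = -(2 * F)) (ef : E * F - F * E = H) :
    casimir4 E F H ∈ Subalgebra.centralizer R ({E, F} : Set (Module.End R M)) := by
  rw [Subalgebra.mem_centralizer_iff]
  intro g hg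
  simp only [Set.mem_insert_iff, Set.mem_singleton_iff] at hg
  rcases hg with rfl | rfl
  · exact (casimir4_comm_E _ _ _ he ef).symm
  · exact (casimir4_comm_F _ _ _ hf ef).symm

/-- … hence so does every polynomial in `C`. -/
theorem aeval_casimir4_comm (E F H : Module.End R M) (he : H * E - E * H = 2 * E)
    (hf : H * F - F * H = -(2 * F)) (ef : E * F - F * E = H) (q : Polynomial R) :
    E * Polynomial.aeval (casimir4 E F H) q = Polynomial.aeval (casimir4 E F H) q * E ∧
      F * Polynomial.aeval (casimir4 E F H) q = Polynomial.aeval (casimir4 E F H) q * F := by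
  have hmem : Polynomial.aeval (casimir4 E F H) q ∈
      Subalgebra.centralizer R ({E, F} : Set (Module.End R M)) :=
    Algebra.adjoin_singleton_le (casimir4_mem_centralizer E F H he hf ef)
      (Polynomial.aeval_mem_adjoin_singleton R _)
  rw [Subalgebra.mem_centralizer_iff] at hmem
  exact ⟨hmem E (by simp), hmem F (by simp)⟩

open Polynomial in
/-- EVERY polynomial `p` with `p(0) = 1`, evaluated at `C`, is a SOUND spin-quotient map:
`x - p(C) x ∈ range E ⊔ range F` for every `x`. -/
theorem sub_aeval_apply_mem (E F H : Module.End R M) (he : H * E - E * H = 2 * E)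
    (hf : H * F - F * H = -(2 * F)) (ef : E * F - F * E = H) (p : R[X]) (hp : p.coeff 0 = 1)
    (x : M) : x - Polynomial.aeval (casimir4 E F H) p x ∈ wardSub E F := by
  obtain ⟨q, hq⟩ := Polynomial.X_dvd_iff.2 (show (1 - p).coeff 0 = 0 by simp [hp])
  have hp' : p = 1 - q * X := by rw [mul_comm, ← hq, sub_sub_cancel]
  obtain ⟨hqE, hqF⟩ := aeval_casimir4_comm E F H he hf ef q
  rw [hp', map_sub, map_one, map_mul, Polynomial.aeval_X]
  exact sub_apply_mem E F H _ ef hqE hqF x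

open Polynomial in
/-- `aeval C (1 - a•X) = 1 - a•C`: the factors of the product projectors below. -/
theorem aeval_one_sub_smul_X (C : Module.End R M) (a : R) :
    Polynomial.aeval C (1 - a • (X : R[X])) = 1 - a • C := by
  simp

open Polynomial in
/-- In particular for the PRODUCT PROJECTORS `∏_{j ∈ s} (1 - a_j C)` (the value at `C` of
`∏_j (1 - a_j X)`, factors in any order).  With `a_j = 1/(4j(j+1))`, `j = 1..k`, this is the projection
onto the invariants of every `𝔰𝔩₂`-module with spins `≤ k` (eigenvalue of `C` on spin `j` is `4j(j+1)`)
along the other isotypic components = the spin-Reynolds map `R_k` of the rev-4 tables. -/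
theorem sub_aevalProd_apply_mem (E F H : Module.End R M) (he : H * E - E * H = 2 * E)
    (hf : H * F - F * H = -(2 * F)) (ef : E * F - F * E = H) {ι : Type*} (s : Finset ι)
    (a : ι → R) (x : M) :
    x - Polynomial.aeval (casimir4 E F H) (∏ j ∈ s, (1 - a j • (X : R[X]))) x ∈ wardSub E F := by
  refine sub_aeval_apply_mem E F H he hf ef _ ?_ x
  rw [Polynomial.coeff_zero_eq_eval_zero, Polynomial.eval_prod]
  simp

end ModuleLevel

/-! ## 2b. Transport along an intertwiner (how a checker plugs in its own FORMAL word module) -/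
section Transport

variable {R : Type*} [CommRing R] {V M : Type*} [AddCommGroup V] [Module R V]
  [AddCommGroup M] [Module R M]

/-- `ev ∘ T_f = T ∘ ev ⇒ ev ∘ T_fⁿ = Tⁿ ∘ ev`. -/
theorem comp_pow_of_comp_eq (ev : V →ₗ[R] M) (Tf : Module.End R V) (T : Module.End R M)
    (h : ev ∘ₗ Tf = T ∘ₗ ev) (n : ℕ) : ev ∘ₗ (Tf ^ n) = (T ^ n) ∘ₗ ev := by
  induction n with
  | zero => rw [pow_zero, pow_zero, Module.End.one_eq_id, Module.End.one_eq_id, LinearMap.comp_id,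
      LinearMap.id_comp]
  | succ n ih => rw [pow_succ, pow_succ, Module.End.mul_eq_comp, Module.End.mul_eq_comp,
      ← LinearMap.comp_assoc, ih, LinearMap.comp_assoc, h, ← LinearMap.comp_assoc]

open Polynomial in
/-- `aeval` transports along an intertwiner: `ev ∘ T_f = T ∘ ev ⇒ ev ∘ p(T_f) = p(T) ∘ ev`. -/
theorem comp_aeval_of_comp_eq (ev : V →ₗ[R] M) (Tf : Module.End R V) (T : Module.End R M)
    (h : ev ∘ₗ Tf = T ∘ₗ ev) (p : R[X]) :
    ev ∘ₗ (Polynomial.aeval Tf p : Module.End R V) = (Polynomial.aeval T p : Module.End R M) ∘ₗ ev := by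
  induction p using Polynomial.induction_on' with
  | add p q hp hq => rw [map_add, map_add, LinearMap.comp_add, LinearMap.add_comp, hp, hq]
  | monomial n a =>
      rw [Polynomial.aeval_monomial, Polynomial.aeval_monomial, Algebra.algebraMap_eq_smul_one,
        Algebra.algebraMap_eq_smul_one, smul_mul_assoc, smul_mul_assoc, one_mul, one_mul,
        LinearMap.comp_smul, LinearMap.smul_comp, comp_pow_of_comp_eq ev Tf T h n]

/-- An intertwiner of the three generators intertwines the Casimirs (no relation among the formal
`E_f, F_f, H_f` is needed — only the three intertwining identities). -/
theorem comp_casimir4_of_comp_eq (ev : V →ₗ[R] M) {Ef Ff Hf : Module.End R V}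
    {E F H : Module.End R M} (hE : ev ∘ₗ Ef = E ∘ₗ ev) (hF : ev ∘ₗ Ff = F ∘ₗ ev)
    (hH : ev ∘ₗ Hf = H ∘ₗ ev) : ev ∘ₗ casimir4 Ef Ff Hf = casimir4 E F H ∘ₗ ev := by
  have hE' : ∀ v, ev (Ef v) = E (ev v) := fun v => LinearMap.congr_fun hE v
  have hF' : ∀ v, ev (Ff v) = F (ev v) := fun v => LinearMap.congr_fun hF v
  have hH' : ∀ v, ev (Hf v) = H (ev v) := fun v => LinearMap.congr_fun hH v
  refine LinearMap.ext fun v => ?_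
  simp only [casimir4, LinearMap.comp_apply, LinearMap.add_apply, Module.End.mul_apply,
    Module.End.ofNat_apply, map_add, map_nsmul, hE', hF', hH']

/-- The commutator intertwines automatically: from the two identities for `E_f, F_f` one gets the
third for `H_f := E_f F_f - F_f E_f` (so a checker needs NO formal `S^z`). -/
theorem comp_comm_of_comp_eq (ev : V →ₗ[R] M) {Ef Ff : Module.End R V} {E F : Module.End R M}
    (hE : ev ∘ₗ Ef = E ∘ₗ ev) (hF : ev ∘ₗ Ff = F ∘ₗ ev) :
    ev ∘ₗ (Ef * Ff - Ff * Ef) = (E * F - F * E) ∘ₗ ev := by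
  have hE' : ∀ v, ev (Ef v) = E (ev v) := fun v => LinearMap.congr_fun hE v
  have hF' : ∀ v, ev (Ff v) = F (ev v) := fun v => LinearMap.congr_fun hF v
  refine LinearMap.ext fun v => ?_
  simp only [LinearMap.comp_apply, LinearMap.sub_apply, Module.End.mul_apply, map_sub, hE', hF']

open Polynomial in
/-- TRANSPORTED SOUNDNESS.  If `ev : V → M` intertwines `(E_f, F_f, H_f)` with an `𝔰𝔩₂`-triple
`(E, F, H)` of `M`, then for every `p` with `p(0) = 1` and every formal vector `v`:
`ev v - ev (p(C_f) v) ∈ range E ⊔ range F` — a table `R := p(C_f)` computed on the FORMAL module is sound. -/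
theorem transport_sub_aeval_mem (ev : V →ₗ[R] M) {Ef Ff Hf : Module.End R V}
    {E F H : Module.End R M} (hE : ev ∘ₗ Ef = E ∘ₗ ev) (hF : ev ∘ₗ Ff = F ∘ₗ ev)
    (hH : ev ∘ₗ Hf = H ∘ₗ ev) (he : H * E - E * H = 2 * E) (hf : H * F - F * H = -(2 * F))
    (ef : E * F - F * E = H) (p : R[X]) (hp : p.coeff 0 = 1) (v : V) :
    ev v - ev (Polynomial.aeval (casimir4 Ef Ff Hf) p v) ∈ wardSub E F := by
  have hv := LinearMap.congr_fun
    (comp_aeval_of_comp_eq ev _ _ (comp_casimir4_of_comp_eq ev hE hF hH) p) v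
  simp only [LinearMap.comp_apply] at hv
  rw [hv]
  exact sub_aeval_apply_mem E F H he hf ef p hp (ev v)

end Transport

/-! ## 3. Window level: `E = ad S⁺`, `F = ad S⁻`, `H = ad (2 S^z)` on the Hubbard Fock window algebra -/
noncomputable section Window

open Matrix Literature.MathematicalPhysics.QuantumLattice

variable {Λ : Type*} [LinearOrder Λ] [Fintype Λ]

/-- Window operators: matrices on the fermionic Fock basis `Finset (Orb Λ)`
(same term as `SpinFreeChecker.Op`). -/
abbrev Op (Λ : Type*) [LinearOrder Λ] [Fintype Λ] := Matrix (Finset (Orb Λ)) (Finset (Orb Λ)) ℂ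

/-- `ad S : X ↦ S X - X S` (same term as `SpinFreeChecker.ad`). -/
def ad (S : Op Λ) : Module.End ℂ (Op Λ) := LinearMap.mulLeft ℂ S - LinearMap.mulRight ℂ S

theorem ad_apply (S X : Op Λ) : ad S X = S * X - X * S := rfl

theorem ad_comm (A B : Op Λ) : ad A * ad B - ad B * ad A = ad (A * B - B * A) := by
  refine LinearMap.ext fun X => ?_
  simp only [LinearMap.sub_apply, Module.End.mul_apply, ad_apply]
  noncomm_ring

theorem ad_add (A B : Op Λ) : ad (A + B) = ad A + ad B := by
  refine LinearMap.ext fun X => ?_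
  simp only [LinearMap.add_apply, ad_apply]
  noncomm_ring

theorem ad_neg (A : Op Λ) : ad (-A) = -ad A := by
  refine LinearMap.ext fun X => ?_
  simp only [LinearMap.neg_apply, ad_apply]
  noncomm_ring

/-- The SU(2) WARD SPAN of the window (same term as `SpinFreeChecker.wardSpan`). -/
def wardSpan (Λ : Type*) [LinearOrder Λ] [Fintype Λ] : Submodule ℂ (Op Λ) :=
  wardSub (ad (spinPlus : Op Λ)) (ad (spinMinus : Op Λ))

theorem wardSpan_eq (Λ : Type*) [LinearOrder Λ] [Fintype Λ] : wardSpan Λ =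
    LinearMap.range (ad (spinPlus : Op Λ)) ⊔ LinearMap.range (ad (spinMinus : Op Λ)) := rfl

/-- `[ad S⁺, ad S⁻] = ad (2 S^z)` (tree: `LiebTwo.isSu2Triple_spin.comm_PM`). -/
theorem ad_rel_EF : ad (spinPlus : Op Λ) * ad spinMinus - ad spinMinus * ad spinPlus =
    ad ((2 : ℂ) • (HubbardWave0.spinZ : Op Λ)) := by
  rw [ad_comm, LiebTwo.isSu2Triple_spin.comm_PM]

/-- `[ad 2S^z, ad S⁺] = 2 ad S⁺` (tree: `comm_ZP`). -/
theorem ad_rel_HE : ad ((2 : ℂ) • (HubbardWave0.spinZ : Op Λ)) * ad spinPlus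
    - ad spinPlus * ad ((2 : ℂ) • (HubbardWave0.spinZ : Op Λ)) = 2 * ad (spinPlus : Op Λ) := by
  rw [ad_comm, smul_mul_assoc, mul_smul_comm, ← smul_sub, LiebTwo.isSu2Triple_spin.comm_ZP,
    two_smul, two_mul, ad_add]

/-- `[ad 2S^z, ad S⁻] = -2 ad S⁻` (tree: `comm_ZM`). -/
theorem ad_rel_HF : ad ((2 : ℂ) • (HubbardWave0.spinZ : Op Λ)) * ad spinMinus
    - ad spinMinus * ad ((2 : ℂ) • (HubbardWave0.spinZ : Op Λ)) = -(2 * ad (spinMinus : Op Λ)) := by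
  rw [ad_comm, smul_mul_assoc, mul_smul_comm, ← smul_sub, LiebTwo.isSu2Triple_spin.comm_ZM,
    smul_neg, two_smul, two_mul, ad_neg, ad_add]

/-- Four times the ADJOINT CASIMIR: `C_ad = 2(ad S⁺ ad S⁻ + ad S⁻ ad S⁺) + (ad 2S^z)²`. -/
def casimirAd (Λ : Type*) [LinearOrder Λ] [Fintype Λ] : Module.End ℂ (Op Λ) :=
  casimir4 (ad (spinPlus : Op Λ)) (ad (spinMinus : Op Λ)) (ad ((2 : ℂ) • (HubbardWave0.spinZ : Op Λ)))

/-- What the checker EVALUATES (by Leibniz + the letter table, as in rev 4):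
`C_ad X = 2([S⁺,[S⁻,X]] + [S⁻,[S⁺,X]]) + [2S^z,[2S^z,X]]`. -/
theorem casimirAd_apply (X : Op Λ) : casimirAd Λ X =
    2 • (ad spinPlus (ad spinMinus X) + ad spinMinus (ad spinPlus X))
      + ad ((2 : ℂ) • HubbardWave0.spinZ) (ad ((2 : ℂ) • HubbardWave0.spinZ) X) := by
  simp [casimirAd, casimir4, Module.End.mul_apply]

/-- ALL-ARITY SOUNDNESS.  For EVERY window operator `X` (any arity, any site pattern, S^z-neutral or
not) and EVERY polynomial `p` with `p(0) = 1`: `X - p(C_ad) X ∈ wardSpan Λ`. -/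
theorem window_sub_aeval_mem (p : Polynomial ℂ) (hp : p.coeff 0 = 1) (X : Op Λ) :
    X - Polynomial.aeval (casimirAd Λ) p X ∈ wardSpan Λ :=
  sub_aeval_apply_mem _ _ _ ad_rel_HE ad_rel_HF ad_rel_EF p hp X

/-- … with EXPLICIT WARD PREIMAGES for any `Q` commuting with `ad S⁺`, `ad S⁻` (e.g. `Q = q(C_ad)`):
`X - (1 - Q C_ad) X = [S⁺, Q(2[S⁻,X] + [S⁻,[2S^z,X]])] + [S⁻, Q(2[S⁺,X] - [S⁺,[2S^z,X]])]`. -/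
theorem window_sub_apply_eq (Q : Module.End ℂ (Op Λ))
    (hQE : ad spinPlus * Q = Q * ad spinPlus) (hQF : ad spinMinus * Q = Q * ad spinMinus) (X : Op Λ) :
    X - (1 - Q * casimirAd Λ) X =
      ad spinPlus (Q ((2 : ℂ) • ad spinMinus X + ad spinMinus (ad ((2 : ℂ) • HubbardWave0.spinZ) X)))
      + ad spinMinus (Q ((2 : ℂ) • ad spinPlus X - ad spinPlus (ad ((2 : ℂ) • HubbardWave0.spinZ) X))) :=
  sub_apply_eq _ _ _ Q ad_rel_EF hQE hQF X

/-- The product projectors of the rev-4 tables, all `k` at once: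
`P_k = p_k(C_ad)`, `p_k(t) = ∏_{j=1}^{k} (1 - t/(4j(j+1)))` (indexed `j ↦ j+1` below). -/
theorem window_sub_reynoldsPoly_mem (k : ℕ) (X : Op Λ) :
    X - Polynomial.aeval (casimirAd Λ)
      (∏ j ∈ Finset.range k,
        (1 - (1 / (4 * ((j : ℂ) + 1) * ((j : ℂ) + 2))) • (Polynomial.X : Polynomial ℂ))) X
      ∈ wardSpan Λ :=
  sub_aevalProd_apply_mem _ _ _ ad_rel_HE ad_rel_HF ad_rel_EF _ _ X

/-- DESCENT TO THE CHECKER'S FORMAL WORD MODULE.  If the checker's evaluation map `ev : V → Op Λ`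
(formal dressed words ↦ window operators) intertwines its formal letter actions `E_f, F_f, H_f` with
`ad S⁺, ad S⁻, ad 2S^z` — three identities proved ONCE from Leibniz + the letter table, generic in the
arity — then the table `R_k := p_k(C_f)`, an exact rational `4^k × 4^k` matrix computed on formal
dressings, is sound: `ev v - ev (R_k v) ∈ wardSpan Λ` for every formal `v` and every `p`, `p(0) = 1`. -/
theorem window_transport_sub_aeval_mem {V : Type*} [AddCommGroup V] [Module ℂ V]
    (ev : V →ₗ[ℂ] Op Λ) {Ef Ff Hf : Module.End ℂ V}
    (hE : ev ∘ₗ Ef = ad (spinPlus : Op Λ) ∘ₗ ev) (hF : ev ∘ₗ Ff = ad (spinMinus : Op Λ) ∘ₗ ev)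
    (hH : ev ∘ₗ Hf = ad ((2 : ℂ) • (HubbardWave0.spinZ : Op Λ)) ∘ₗ ev)
    (p : Polynomial ℂ) (hp : p.coeff 0 = 1) (v : V) :
    ev v - ev (Polynomial.aeval (casimir4 Ef Ff Hf) p v) ∈ wardSpan Λ :=
  transport_sub_aeval_mem ev hE hF hH ad_rel_HE ad_rel_HF ad_rel_EF p hp v

/-- Same, with only TWO intertwining identities: take `H_f := E_f F_f - F_f E_f` (no formal `S^z`;
`[ad S⁺, ad S⁻] = ad 2S^z` supplies the third identity). -/
theorem window_transport_sub_aeval_mem₂ {V : Type*} [AddCommGroup V] [Module ℂ V]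
    (ev : V →ₗ[ℂ] Op Λ) {Ef Ff : Module.End ℂ V}
    (hE : ev ∘ₗ Ef = ad (spinPlus : Op Λ) ∘ₗ ev) (hF : ev ∘ₗ Ff = ad (spinMinus : Op Λ) ∘ₗ ev)
    (p : Polynomial ℂ) (hp : p.coeff 0 = 1) (v : V) :
    ev v - ev (Polynomial.aeval (casimir4 Ef Ff (Ef * Ff - Ff * Ef)) p v) ∈ wardSpan Λ := by
  have hH : ev ∘ₗ (Ef * Ff - Ff * Ef) = ad ((2 : ℂ) • (HubbardWave0.spinZ : Op Λ)) ∘ₗ ev := by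
    rw [← ad_rel_EF]
    exact comp_comm_of_comp_eq ev hE hF
  exact window_transport_sub_aeval_mem ev hE hF hH p hp v

/-- LEIBNIZ (the one identity, with the letter table, behind the intertwining proofs):
`ad S (X Y) = (ad S X) Y + X (ad S Y)`. -/
theorem ad_mul (S X Y : Op Λ) : ad S (X * Y) = ad S X * Y + X * ad S Y := by
  simp only [ad_apply]
  noncomm_ring

/-- CHECKER'S FINAL STEP, all arities: a Ward-null functional agrees on `X` and on its quotient image
`p(C_ad) X` — so a replay may store and test only the spin-free images. -/
theorem wardNull_apply_aeval_eq (ω : Op Λ →ₗ[ℂ] ℂ)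
    (hP : ∀ Y : Op Λ, ω (spinPlus * Y - Y * spinPlus) = 0)
    (hM : ∀ Y : Op Λ, ω (spinMinus * Y - Y * spinMinus) = 0)
    (p : Polynomial ℂ) (hp : p.coeff 0 = 1) (X : Op Λ) :
    ω X = ω (Polynomial.aeval (casimirAd Λ) p X) := by
  have hle : wardSpan Λ ≤ LinearMap.ker ω := by
    unfold wardSpan wardSub
    refine sup_le ?_ ?_ <;> rintro _ ⟨Y, rfl⟩
    · exact LinearMap.mem_ker.2 (hP Y)
    · exact LinearMap.mem_ker.2 (hM Y)
  have h := hle (window_sub_aeval_mem p hp X)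
  rwa [LinearMap.mem_ker, map_sub, sub_eq_zero] at h

end Window

end Summit.Ventures.CertifiedManyBodySolver.Cruxes.LowerEdge_ge_m83o100.SpinReynoldsCasimir
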